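import Summits.HubbardSuperconductivity.HubbardSuperconductivity.Theses.FluxSpectroscopy
import Literature.MathematicalPhysics.QuantumLattice.HubbardKleinBottleFlux

/-!
# `Lines/birth.lean` — birth-certificate skeleton (BC3) for crux `FluxWindow`
(item stmt-HubbardSuperconductivity-1818, rank-3 crux of route `FluxSpectroscopy`,
sub `HubbardSuperconductivity`; registrar `planner-skel-stmt-HubbardSuperconductivity-1818-0`,
2026-08-17, mode skeleton-register: no new routes, no proving beyond the assembly).

The crux is FIXED — its decl and signature are the route's
(`Summit.HubbardSuperconductivity.HubbardSuperconductivity.Theses.FluxSpectroscopy.FluxWindow`, rev 1):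
`∃ U > 0, δ ∈ (0, 1/2)` with the FLUX CRITERION `FC_T(U,δ)` — `∃ ρ > 0`, eventually in even `L`,
`ρ θ² ≤ E^T_L(θ) − E^T_L(0)` for ALL `|θ| ≤ π/2` — AND the KLEIN HALF-FLUX PREFERENCE `FC_K(U,δ)` —
`∃ κ > 0`, eventually in even `L`, `κ ≤ E^K_L(0) − E^K_L(π/2)`.  Both inline envelopes of the route
file are NAMED Literature objects since 2026-08-15 (grounding note g21-0): the torus envelope `ET` IS
`fluxEnergy L U δ θ` (`HubbardTorusFlux.lean`, by `rfl`), and the Klein-bottle envelope `EK` is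
`kleinBottleFluxEnergy L U δ θ` (`HubbardKleinBottleFlux.lean`, via `hubbardKleinBottleFlux_eq_inline`);
this file states everything over the names and discharges the identification in the assembly.

## The seam: o(1)-robust stiffness × finite-volume rigidity at zero flux

`FC_T` as typed asks an EXACT parabola `ρ θ²` below the finite-volume envelope down to `θ = 0` at
every large even side.  The refuters' standing objection on this item (evidence
`REVIEW-FluxSpectroscopy-gen1.md`, "FC_T small-θ fragility", recommended o(1)-robust restatement
FCT′/FCT″) is exactly that this conflates two statements of different nature:

* the PHYSICS — an `O(1)` superfluid stiffness up to half a pair-flux quantum, which any engine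
  (Kohn/Scalapino–White–Zhang curvature + a positive floor away from zero flux: "the shape a gapped
  holonomy spectrum delivers", cf. the sibling clause (A)(i) of `EatTheGoldstone.HiggsShadow`) can only
  deliver modulo `o(1)` finite-size slack; and
* a FINITE-VOLUME RIGIDITY statement at zero flux — that `θ = 0` is an exact local minimiser of every
  large even envelope with `L`-uniform curvature, i.e. no state of the zero-flux sector ground multiplet
  carries a persistent current (open shells are closed by pairing) and the paramagnetic current response
  does not overshoot at small `θ`.  For a metal (open-shell Fermi sea) the envelope has a local MAXIMUM at
  `θ = 0` at infinitely many `L`; in a stiff window this is the residual, genuinely finite-size claim.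

The crux is cut along exactly that seam — TWO registered stubs:

* `stub_robustWindow` (the physics; open, summit-depth, size XL): `∃ U > 0, δ ∈ (0,1/2)` with
  `RobustTorusStiffness U δ` — `∃ ρ₀, η > 0, ∀ ε > 0`, eventually in even `L`,
  `min (ρ₀ θ²) η − ε ≤ E^T_L(θ) − E^T_L(0)` for `0 ≤ θ ≤ π/2` (floor form, o(1) slack; the half-range
  `0 ≤ θ` suffices by the PROVED evenness `fluxEnergy_neg`) — AND `KleinHalfFluxPreference U δ`
  (= `FC_K` verbatim over `kleinBottleFluxEnergy`; `FC_K` is already o(1)-robust as typed: `κ/2` absorbs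
  any slack).  NOT the crux reworded: it does not give `FC_T` back (no control of the sign of
  `E^T_L(θ) − E^T_L(0)` for `θ² ≲ ε/ρ₀`), and it is implied by the crux.
* `stub_zeroFluxRigidity` (finite-volume rigidity; open, size L–XL): for all `U > 0`, `δ ∈ (0,1/2)`,
  `RobustTorusStiffness U δ → ZeroFluxRigidity U δ` — `∃ ρ₁, θ₁ > 0`, eventually in even `L`,
  `ρ₁ θ² ≤ E^T_L(θ) − E^T_L(0)` for `0 ≤ θ ≤ θ₁`.  Conditional on the stiff window (unconditionally it is
  false for open-shell metals); expected inputs: evenness + `2π`-periodicity of the envelope (proved: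
  `fluxEnergy_neg`, `fluxEnergy_periodic`), the uniform-twist gauge (`HubbardTorusFluxGauge.lean`),
  second-order (current–current) perturbation bounds in the sector, and a pairing/parity gap closing the
  shells.  NOT the crux: no Klein clause, no window, small flux only.  It is the line's WEAKEST stub and
  deliberately so: d-wave BCS heuristics (near-nodal allowed momenta give a negative `O(1/(dist_L L²))`
  finite-size curvature, a `−v|θ|/L` cusp when a node sits on the momentum grid — see its docstring) say
  the exact parabola can fail at infinitely many even `L` in a genuine d-wave window, where only the
  robust form survives; refuting THIS stub (not stub 1) is then the informative event, and the recorded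
  repair is the refuters' FCT′ restatement of `FC_T`.

`FluxWindow_of : Sig.stub_robustWindow → Sig.stub_zeroFluxRigidity → FluxWindow` is PROVED (no
`sorry`): (1) `torusFluxCriterion_of_robust_of_rigid` glues the two torus statements into `FC_T` with
`ρ := min ρ₁ (2m/π²)`, `m := min (ρ₀ θ₁²) η`, `ε := m/2` — small flux from rigidity, `θ₁ < θ ≤ π/2`
from the floor form (`min (ρ₀θ²) η ≥ m`, `θ² ≤ π²/4`), negative `θ` by `fluxEnergy_neg`; (2)
`fluxWindow_iff` identifies the route decl with the named form (`ET = fluxEnergy` by `rfl`,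
`EK = kleinBottleFluxEnergy` by `hubbardKleinBottleFlux_eq_inline`).  `FluxWindow_proof : FluxWindow`
is the skeleton in final shape (depends on `sorryAx` through the two stubs only).

## Disproof used / negatives

No `Cruxes/FluxWindow/Disproof.lean` exists yet (`ledger crux ls stmt-HubbardSuperconductivity-1818`:
no workfiles, 2026-08-17), so no `_false_without_` obstruction is on record; `ledger negatives
--problem HubbardSuperconductivity` (2 statements: CooperPairDMottWalk breathing self-duality,
AposterioriCapRg KLS openness) — neither equal or trivially equivalent to a stub.  The refuter objection
(small-θ fragility) is honoured AT `stub_zeroFluxRigidity` ("the line isolates the fragile clause there").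

## BC3 audit (this seat; raw outputs in the seat's NOTES.md `birth-certificate:`)

`lean check --json` rc 0 with `sorry` exactly in `stub_robustWindow`, `stub_zeroFluxRigidity`
(sorry count 2 = stub count, zero elsewhere); probes `stub → FluxWindow` and
`stub → HubbardSuperconductivity` by `first | exact? | simpa | aesop` FAIL for both stubs (4/4),
file `bc/FluxWindow_stub_probes.lean` of the seat folder; control `FluxWindow → FluxWindow` succeeds.
-/

set_option linter.dupNamespace false

noncomputable section

namespace Summit.HubbardSuperconductivity.HubbardSuperconductivity.Cruxes.FluxWindow.Birth

open Filter
open Literature.MathematicalPhysics.QuantumLattice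
open Summit.HubbardSuperconductivity.HubbardSuperconductivity.Theses.FluxSpectroscopy (FluxWindow)

/-! ### Vocabulary (plain `def`s over the named Literature envelopes) -/

/-- `FC_T(U,δ)` of the route, verbatim, over the named torus flux envelope `fluxEnergy`
(`= ET` of the route file by `rfl`): `∃ ρ > 0`, eventually in even `L`, `ρ θ² ≤ E^T_L(θ) − E^T_L(0)`
for all `|θ| ≤ π/2`. -/
def TorusFluxCriterion (U δ : ℝ) : Prop :=
  ∃ ρ : ℝ, 0 < ρ ∧ ∀ᶠ L : ℕ in atTop, ∀ [NeZero L], Even L →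
    ∀ θ : ℝ, |θ| ≤ Real.pi / 2 → ρ * θ ^ 2 ≤ fluxEnergy L U δ θ - fluxEnergy L U δ 0

/-- `FC_K(U,δ)` of the route, verbatim, over the named Klein-bottle envelope `kleinBottleFluxEnergy`
(`= EK` of the route file by `hubbardKleinBottleFlux_eq_inline`): `∃ κ > 0`, eventually in even `L`,
`κ ≤ E^K_L(0) − E^K_L(π/2)` (the diagonal-glide Klein bottle prefers half a superconducting flux
quantum by an `O(1)` margin). Already o(1)-robust as typed. -/
def KleinHalfFluxPreference (U δ : ℝ) : Prop :=
  ∃ κ : ℝ, 0 < κ ∧ ∀ᶠ L : ℕ in atTop, ∀ [NeZero L], Even L →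
    κ ≤ kleinBottleFluxEnergy L U δ 0 - kleinBottleFluxEnergy L U δ (Real.pi / 2)

/-- ROBUST TORUS STIFFNESS (floor form with o(1) slack — the refuters' FCT′, the sibling
`HiggsShadow` (A)(i) shape): `∃ ρ₀, η > 0` such that for every `ε > 0`, eventually in even `L`,
`min (ρ₀ θ²) η − ε ≤ E^T_L(θ) − E^T_L(0)` for `0 ≤ θ ≤ π/2` (Kohn/SWZ curvature near zero flux, a
positive floor up to half a pair-flux quantum, `o(1)` finite-size wiggles absorbed by `ε`). -/
def RobustTorusStiffness (U δ : ℝ) : Prop :=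
  ∃ ρ₀ η : ℝ, 0 < ρ₀ ∧ 0 < η ∧ ∀ ε : ℝ, 0 < ε → ∀ᶠ L : ℕ in atTop, ∀ [NeZero L], Even L →
    ∀ θ : ℝ, 0 ≤ θ → θ ≤ Real.pi / 2 →
      min (ρ₀ * θ ^ 2) η - ε ≤ fluxEnergy L U δ θ - fluxEnergy L U δ 0

/-- ZERO-FLUX RIGIDITY (finite volume, exact): `∃ ρ₁, θ₁ > 0`, eventually in even `L`,
`ρ₁ θ² ≤ E^T_L(θ) − E^T_L(0)` for `0 ≤ θ ≤ θ₁` — zero flux is an exact local minimiser of every large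
even envelope with `L`-uniform curvature (no persistent current in the zero-flux sector ground
multiplet; the paramagnetic response does not overshoot at small flux). -/
def ZeroFluxRigidity (U δ : ℝ) : Prop :=
  ∃ ρ₁ θ₁ : ℝ, 0 < ρ₁ ∧ 0 < θ₁ ∧ ∀ᶠ L : ℕ in atTop, ∀ [NeZero L], Even L →
    ∀ θ : ℝ, 0 ≤ θ → θ ≤ θ₁ → ρ₁ * θ ^ 2 ≤ fluxEnergy L U δ θ - fluxEnergy L U δ 0

/-! ### Stub signatures (`Sig.stub_*`: the hypothesis heads of `FluxWindow_of` carry the stub names) -/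

/-- STUB 1 signature — THE ROBUST WINDOW: some repulsive `U` and hole doping `δ ∈ (0,1/2)` carry
robust `O(1)` torus stiffness up to half a pair-flux quantum AND the Klein half-flux preference. -/
def Sig.stub_robustWindow : Prop :=
  ∃ U : ℝ, 0 < U ∧ ∃ δ ∈ Set.Ioo (0 : ℝ) (1 / 2),
    RobustTorusStiffness U δ ∧ KleinHalfFluxPreference U δ

/-- STUB 2 signature — ZERO-FLUX RIGIDITY IN A STIFF WINDOW: wherever the torus is robustly stiff,
zero flux is eventually an exact local minimiser with uniform curvature. -/
def Sig.stub_zeroFluxRigidity : Prop :=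
  ∀ U δ : ℝ, 0 < U → δ ∈ Set.Ioo (0 : ℝ) (1 / 2) →
    RobustTorusStiffness U δ → ZeroFluxRigidity U δ

/-! ### Registered stubs (sorries live ONLY here) -/

/-- Registered stub 1 — the robust window (the physics: summit-depth `O(1)` stiffness lower bound in
some `(U, δ)` of the pure `t' = 0` model + the Klein-bottle sign; why it might fail = why the crux might:
stripes/PDW at the popular `U ≈ 8, δ ≈ 1/8`, `L ≫ ξ ~ e^{c/U²}` at weak coupling, `FC_K` has the
d-wave sign only for a glide-odd condensate). Sources: ScalapinoWhiteZhang1993, Kohn1964,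
ByersYang1961, GeshkenbeinLarkinBarone1987, SigristRice1992, TsueiKirtley2000, QinEtAl2020. -/
theorem stub_robustWindow :
    ∃ U : ℝ, 0 < U ∧ ∃ δ ∈ Set.Ioo (0 : ℝ) (1 / 2),
      RobustTorusStiffness U δ ∧ KleinHalfFluxPreference U δ := by
  sorry

/-- Registered stub 2 — zero-flux rigidity in a stiff window (finite-volume: Bloch/Byers–Yang evenness
and periodicity, uniform-twist gauge, second-order current–current bounds, pairing gap closing the open
shells). WHY IT MIGHT FAIL — this stub carries the whole "small-θ fragility" of `FC_T` as typed, and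
the d-wave heuristics point AGAINST it: (a) a current-carrying member of a degenerate zero-flux ground
multiplet at infinitely many even `L` makes `θ = 0` a local MAXIMUM of the envelope; (b) NODAL
d-wave BCS: an allowed diagonal momentum `(2π/L)(n,n)` at energy distance `|a| = v_F·dist_L` from a
node contributes `−v_Δ² θ²/(2|a|L²)` to the finite-size curvature of `E^T_L` at `θ = 0` (expand
`−√((a + v_F θ/L)² + (v_Δ θ/L)²)`; the linear terms cancel between `±k`), which beats the bulk `+2ρ_s θ²`
whenever `dist_L ≲ v_Δ²/(ρ_s v_F L²)` — for generic node positions `‖αL‖ < C/L` happens for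
infinitely many even `L` — and is a `−v|θ|/L` cusp when the node sits ON the grid: an o(1),
`O(|θ|/L)`-sized violation of the exact parabola that the robust form (stub 1) never sees. If this stub
is refuted/abandoned, the tenure repair is the refuters' FCT′: restate `FC_T` in the floor/robust form
`RobustTorusStiffness` (and weaken `FluxBridge`'s hypothesis accordingly). Sources: Bohm1949,
ByersYang1961, Watanabe2019, TadaKoma2016, ScalapinoWhiteZhang1993, YipSauls1992 (nonlinear Meissner
effect of nodal quasiparticles), LoderEtAl2007. -/
theorem stub_zeroFluxRigidity :
    ∀ U δ : ℝ, 0 < U → δ ∈ Set.Ioo (0 : ℝ) (1 / 2) →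
      RobustTorusStiffness U δ → ZeroFluxRigidity U δ := by
  sorry

/-! ### Gluing (proved) -/

/-- **Robust stiffness + zero-flux rigidity ⇒ the exact flux criterion `FC_T`.** With
`m := min (ρ₀ θ₁²) η > 0`, `ε := m/2` and `ρ := min ρ₁ (2m/π²)`: for `0 ≤ θ ≤ θ₁` rigidity gives
`ρ θ² ≤ ρ₁ θ² ≤ ΔE`; for `θ₁ < θ ≤ π/2` the floor form gives `ΔE ≥ min (ρ₀θ²) η − m/2 ≥ m/2 ≥ (2m/π²) θ²`
(`θ² ≤ π²/4`); negative `θ` by evenness of the envelope (`fluxEnergy_neg`). [bookkeeping + real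
arithmetic] -/
theorem torusFluxCriterion_of_robust_of_rigid {U δ : ℝ}
    (hR : RobustTorusStiffness U δ) (hZ : ZeroFluxRigidity U δ) : TorusFluxCriterion U δ := by
  obtain ⟨ρ₀, η, hρ₀, hη, hR⟩ := hR
  obtain ⟨ρ₁, θ₁, hρ₁, hθ₁, hZ⟩ := hZ
  -- the floor on `[θ₁, π/2]` and the slack
  set m : ℝ := min (ρ₀ * θ₁ ^ 2) η with hm_def
  have hm : 0 < m := lt_min (by positivity) hη
  have hπ : 0 < Real.pi := Real.pi_pos
  refine ⟨min ρ₁ (2 * m / Real.pi ^ 2), lt_min hρ₁ (by positivity), ?_⟩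
  filter_upwards [hR (m / 2) (half_pos hm), hZ] with L hRL hZL
  intro _ hLe θ hθ
  -- the half-range statement `0 ≤ θ ≤ π/2`
  have key : ∀ θ : ℝ, 0 ≤ θ → θ ≤ Real.pi / 2 →
      min ρ₁ (2 * m / Real.pi ^ 2) * θ ^ 2 ≤ fluxEnergy L U δ θ - fluxEnergy L U δ 0 := by
    intro θ h0 hθ'
    by_cases hsmall : θ ≤ θ₁
    · calc min ρ₁ (2 * m / Real.pi ^ 2) * θ ^ 2 ≤ ρ₁ * θ ^ 2 :=
            mul_le_mul_of_nonneg_right (min_le_left _ _) (by positivity)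
        _ ≤ fluxEnergy L U δ θ - fluxEnergy L U δ 0 := hZL hLe θ h0 hsmall
    · have hlt : θ₁ < θ := lt_of_not_ge hsmall
      have hfloor := hRL hLe θ h0 hθ'
      -- `m ≤ min (ρ₀ θ²) η` on `θ₁ < θ`
      have hθ₁θ : θ₁ ^ 2 ≤ θ ^ 2 := pow_le_pow_left₀ hθ₁.le hlt.le 2
      have hmin : m ≤ min (ρ₀ * θ ^ 2) η :=
        min_le_min (mul_le_mul_of_nonneg_left hθ₁θ hρ₀.le) le_rfl
      -- `θ² ≤ π²/4`
      have hθsq : θ ^ 2 ≤ (Real.pi / 2) ^ 2 := pow_le_pow_left₀ h0 hθ' 2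
      calc min ρ₁ (2 * m / Real.pi ^ 2) * θ ^ 2 ≤ 2 * m / Real.pi ^ 2 * θ ^ 2 :=
            mul_le_mul_of_nonneg_right (min_le_right _ _) (by positivity)
        _ ≤ 2 * m / Real.pi ^ 2 * (Real.pi / 2) ^ 2 :=
            mul_le_mul_of_nonneg_left hθsq (by positivity)
        _ = m / 2 := by
            field_simp
        _ ≤ min (ρ₀ * θ ^ 2) η - m / 2 := by linarith
        _ ≤ fluxEnergy L U δ θ - fluxEnergy L U δ 0 := hfloor
  -- both signs of `θ` by evenness of the envelope
  rcases le_total 0 θ with h0 | h0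
  · exact key θ h0 ((le_abs_self θ).trans hθ)
  · have h := key (-θ) (by linarith) ((neg_le_abs θ).trans hθ)
    rwa [fluxEnergy_neg, neg_sq] at h

/-- **The route decl over the names.** `FluxWindow` unfolds to
`∃ U > 0, δ ∈ (0,1/2), TorusFluxCriterion U δ ∧ KleinHalfFluxPreference U δ`: the inline `ET` is
`fluxEnergy` by `rfl`, the inline `EK` is `kleinBottleFluxEnergy` by `hubbardKleinBottleFlux_eq_inline`.
[bookkeeping] -/
theorem fluxWindow_iff :
    FluxWindow ↔ ∃ U : ℝ, 0 < U ∧ ∃ δ ∈ Set.Ioo (0 : ℝ) (1 / 2),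
      TorusFluxCriterion U δ ∧ KleinHalfFluxPreference U δ := by
  unfold FluxWindow TorusFluxCriterion KleinHalfFluxPreference kleinBottleFluxEnergy
  simp only [hubbardKleinBottleFlux_eq_inline]
  rfl

/-! ### Composition -/

/-- **The line closes the crux BY NAME modulo the two registered stubs.** Take the window `(U, δ)`,
the robust stiffness and the Klein preference from stub 1; stub 2 upgrades the robust stiffness to
zero-flux rigidity at the same `(U, δ)`; `torusFluxCriterion_of_robust_of_rigid` glues them into `FC_T`;
`fluxWindow_iff` returns to the route decl. -/
theorem FluxWindow_of : Sig.stub_robustWindow → Sig.stub_zeroFluxRigidity → FluxWindow := by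
  rintro ⟨U, hU, δ, hδ, hR, hK⟩ hrig
  exact fluxWindow_iff.2
    ⟨U, hU, δ, hδ, torusFluxCriterion_of_robust_of_rigid hR (hrig U δ hU hδ hR), hK⟩

/-- The skeleton in its final shape (D-0027 §3.3): the crux BY NAME from the two registered stubs;
it becomes the crux proof when the last `stub_*` is discharged (until then it depends on `sorryAx`
through the stubs only — no `sorry` of its own). -/
theorem FluxWindow_proof : FluxWindow :=
  FluxWindow_of stub_robustWindow stub_zeroFluxRigidity

end Summit.HubbardSuperconductivity.HubbardSuperconductivity.Cruxes.FluxWindow.Birth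

end
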